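import Summits.BirchSwinnertonDyer.Rank1Residual.X10.MuTransferThreeOfFine
import Summits.BirchSwinnertonDyer.Rank1Residual.Partition.MainConjectures
import Summits.BirchSwinnertonDyer.BirchSwinnertonDyer.Theorems.Rank1ResidualX9MuTransfer
import Literature.NumberTheory.EllipticCurves.GreenbergVatsal2000.MultiplicativeReduction
import Literature.NumberTheory.EllipticCurves.Rank1Residual.PeriodUnitProofs
import Literature.NumberTheory.EllipticCurves.Wuthrich2014.RankOneEngineOddPrimeProofs
import Literature.NumberTheory.EllipticCurves.PadicSigmaThreeExistence
import HarnessLib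

/-!
# Class X9, PER PAIR: Kato's RATIONAL divisibility + `μ = 0` at the pair + a `λ`-MATCH (`λ_alg ≥ λ_an`)
# give Mazur's INTEGRAL main conjecture `char_Λ X(E/ℚ_∞) = (L_p(E))` at the pair — the rank-0 UNIT
# cells (`L_p(E, 0) ∈ ℤ_p^×`) and the rank-1 cells with `[T¹]L_p(E) ∈ ℤ_p^×`, hence Miller's
# `BSD(E,p)` there, with ONE coefficient of `L_p` as the whole certificate (print cell `bsd-print-x9`,
# seat p3; theorems only, nothing booked)

Seat p3 of the D-0131 (2) print cell `bsd-print-x9`; strategy «Kato's divisibility WITHOUT the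
SL₂-image hypothesis (Kato 2004 Thm 12.5 / 17.4 (2), divisibility in `Λ[1/p]`) + certified analytic
`(μ, λ)` per pair ⇒ integral equality where descent data force `λ_alg = λ_an` (rank-0 unit cells
first)». Companion of `Theorems/PrintX9KatoEulerHalf.lean` (same seat: the Euler-system half and
`BSD(E,p)` at the `p ∤ #Ш_an` pairs). Here the mechanism is Greenberg–Vatsal's `λ`-argument
(Invent. Math. 142 (2000) p. 20, tree lemma `GreenbergVatsal2000.isUnit_of_mul_eq_of_order_map_eq`):

§1 `X9.mazurMainConjecture_of_kato_of_mu_eq_zero_of_order_le` — at an X9 pair `(E, p)` (non-CM,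
`p ≥ 5` good ordinary, `E[p]` irreducible, `ρ̄` not surjective), for every cyclotomic datum: Kato's
clause (2) (`p^n L_p ∈ ι(char_Λ X)`, tree fact `kato_divisibility`, NO image hypothesis) with
`μ(X) = 0` at the pair (`hμ`) gives `f_E · h' = G` in `Λ = ℤ_p⟦T⟧` (`(f_E) = char_Λ X`, `ι G = L_p(f, α)`,
Greenberg–Vatsal Prop. 3.7); if moreover `L_p` has a unit coefficient (`hcert`, so `μ(G) = 0`) and
`ord_T(G mod p) ≤ ord_T(f_E mod p)` (`hlam`: "`λ_an ≤ λ_alg`" — the one-sided `λ`-MATCH; the other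
inequality is automatic), then `h'` is a unit, i.e. `char_Λ X = (G)`: Mazur's main conjecture at the
pair in the Néron normalisation (`MazurMainConjecture W p`, the period ratio `ϖ` being a `p`-adic unit).
§2 Two dischargers of `hlam` by ONE coefficient: (a) the rank-0 UNIT cell `‖L_p(f, α)(0)‖ = 1`
(`ord_T(G mod p) = 0`); (b) the rank-1 cell `‖[T¹]L_p(f, α)‖ = 1` with `ord_{s=1} L(E,s) = 1`
(`ord_T(G mod p) ≤ 1 ≤ ord_T f_E`, the latter by Perrin-Riou–Schneider clause 1, `T^{rank} ∣ f_E`,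
rank `= 1` by GZK). §3 Headlines modulo F1 (Kato's zeta-element package, from which both
`kato_divisibility` and the `μ`-transfer follow — `X10.kato_divisibility_of_fine`, `X10.mu_eq_zero_of_fine`):
`X9.mazurMainConjecture_of_fine_of_norm_constantCoeff_eq_one` / `X9.bsdp_of_fine_of_norm_constantCoeff_eq_one`
(rank-0 unit cell: F1 + Greenberg Thm. 4.1 + modularity + GZK + period unit + ONE coefficient ⇒ the
integral main conjecture AND `BSD(E,p)`), and `X9.mazurMainConjecture_rankOne_of_fine_of_norm_coeff_one_eq_one` /
`X9.bsdp_rankOne_of_fine_of_norm_coeff_one_eq_one` (rank 1: F1 + Perrin-Riou–Schneider + Perrin-Riou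
1987 + modularity + GZK + period unit + ONE coefficient ⇒ the integral main conjecture AND `BSD(E,p)`;
the Schneider certificate is READ OFF the same coefficient, `coeff_one_padicLFunction_ne_zero_iff_schneider_odd`).

NO Burungale–Castella–Skinner fact, no rational main conjecture, no `#Ш_an` datum, no Heegner index, no
image hypothesis beyond X9's `¬ Surj`. Currency: PER PAIR (one-coefficient certificate rows). Not a
class theorem: the leaf `BSDpOnClassX9` needs the class-wide analytic `μ = 0` (item 19630). Beyond
print: "irreducible NON-surjective good ordinary `p ≥ 5`, `L_p(E,0) ∈ ℤ_p^×` ⇒ `char_Λ X = Λ` and BSD_p"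
is not a printed theorem (Greenberg LNM 1716 Prop. 3.8 / Thm. 4.1 need `Sel_p(E/ℚ) = 0` as INPUT; Kato
17.4 (3) needs (12.5.2)); kernel-checked here modulo the published input F1.

References: [Kato2004Asterisque] Thm. 12.5, 12.6, 17.4 (2), §17.13; [GreenbergVatsal2000] (1)–(2),
Prop. 3.7, p. 20; [GreenbergLNM1716] Conj. 1.11, Thm. 4.1; [PerrinRiou1987] §1.4 Cor. 1.8;
[BalakrishnanMullerStein2015] Thm. 1.7; [MazurSteinTate2006] Thm. 1.3; [Miller2011LMS] Def. 1.1;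
[Washington1997] §13.1; cell `bsd-smallim` KOLY-MEMO §5.7 (route SmallImageMuTransfer, items 19629/19843).
-/

set_option linter.dupNamespace false
set_option autoImplicit false

noncomputable section

open scoped Classical MatrixGroups ModularForm

open CongruenceSubgroup WeierstrassCurve Literature.NumberTheory.EllipticCurves
  Literature.NumberTheory.EllipticCurves.ModularForms Literature.NumberTheory.EllipticCurves.Rank1Residual
  Literature.NumberTheory.EllipticCurves.Rank1Residual.Typed
  Literature.NumberTheory.EllipticCurves.Wuthrich2014
  Literature.NumberTheory.EllipticCurves.Kato2004
  Summit.BirchSwinnertonDyer.BirchSwinnertonDyer.Theorems.Rank1ResidualX1Defs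

namespace Summit.BirchSwinnertonDyer.BirchSwinnertonDyer.Rank1Residual

variable (W : WeierstrassCurve ℚ) [W.IsElliptic] [W.IsGloballyMinimal] (p : ℕ) [Fact p.Prime]

omit [Fact p.Prime] in
/-- A unit of `ℤ_p` reduces to a non-zero element of `𝔽_p` (`ker toZMod = 𝔪`). [folklore] -/
theorem toZMod_ne_zero_of_isUnit [Fact p.Prime] {x : ℤ_[p]} (hx : IsUnit x) :
    PadicInt.toZMod x ≠ 0 := by
  intro h0
  have hmem : x ∈ RingHom.ker (PadicInt.toZMod (p := p)) := h0
  rw [PadicInt.ker_toZMod, IsLocalRing.mem_maximalIdeal] at hmem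
  exact hmem hx

/-! ### §1. The `λ`-match: Kato (2) + `μ = 0` + `λ_an ≤ λ_alg` ⟹ Mazur's main conjecture at the pair -/

/-- **X9, per pair: Kato Thm. 17.4 (2) + `μ(X(E/ℚ_∞)) = 0` + one unit coefficient of `L_p` + the
one-sided `λ`-match ⟹ Mazur's INTEGRAL cyclotomic main conjecture at the pair** (`MazurMainConjecture W p`:
for every cyclotomic `(κ, γ)`, newform `f` of level `N_E`, `ϖ · Ω_E = Ω⁺_f` and dual datum `D`, `X` is
torsion and `char_Λ X = (g)` with `ι g = ϖ · L_p(f, α)`). Hypotheses: `hK` = the tree fact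
`kato_divisibility` at the pair (only clause (2) is used; clause (3)'s antecedent is dead on X9); `hμ`
(Greenberg's `μ = 0` at the pair — on X9 supplied by the `μ`-transfer, §3); `hcert` (some coefficient of
`L_p(f, α)` is a `p`-adic unit); `hlam`: for a generator `f_E` of `char_Λ X` and the integral `G` with
`ι G = L_p(f, α)`, `ord_T(G mod p) ≤ ord_T(f_E mod p)` ("`λ_an ≤ λ_alg`"). Proof: as in
`X10.divisibility_of_kato_of_mu_eq_zero`, `f_E · h' = G` in `Λ` (the prime `p` of the UFD `Λ` divides
Kato's cofactor `n` times since `p ∤ f_E`); then Greenberg–Vatsal's `λ`-argument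
(`isUnit_of_mul_eq_of_order_map_eq`: orders add in the domain `𝔽_p⟦T⟧`) makes `h'` a unit, so
`char_Λ X = (G) = (ϖ · G)` (`ord_p ϖ = 0`, period unit `h5`).
[cite: Kato2004Asterisque, Thm. 17.4 (2) (p. 273)] [cite: GreenbergVatsal2000, p. 2 (1)–(2), Prop. (3.7) and p. 20]
[cite: Washington1997, §13.1] -/
theorem X9.mazurMainConjecture_of_kato_of_mu_eq_zero_of_order_le
    (h5 : realPeriodRat_eq_unit_mul_plusPeriod)
    (hK : ∀ (κ : ZpExtension ℚ p) (γ : Field.absoluteGaloisGroup ℚ) [NeZero (W.conductorNorm ℤ)]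
      (f : CuspForm (Gamma0 (W.conductorNorm ℤ)) 2), kato_divisibility W p (κ := κ) (γ := γ) (f := f))
    (hX9 : ClassX9 W p)
    (hμ : ∀ (κ : ZpExtension ℚ p) (γ : Field.absoluteGaloisGroup ℚ),
        κ.IsCyclotomic → κ.IsTopGenerator γ → IsCyclotomicVariable p γ →
      ∀ (D : W.SelmerDualData κ γ), D.mu = 0)
    (hcert : ∀ [NeZero (W.conductorNorm ℤ)] (f : CuspForm (Gamma0 (W.conductorNorm ℤ)) 2),
      IsNewformOf W f → ∃ n : ℕ, ‖PowerSeries.coeff n (padicLFunction f (unitRoot W p : ℚ_[p]))‖ = 1)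
    (hlam : ∀ (κ : ZpExtension ℚ p) (γ : Field.absoluteGaloisGroup ℚ),
        κ.IsCyclotomic → κ.IsTopGenerator γ → IsCyclotomicVariable p γ →
      ∀ [NeZero (W.conductorNorm ℤ)] (f : CuspForm (Gamma0 (W.conductorNorm ℤ)) 2), IsNewformOf W f →
      ∀ (D : W.SelmerDualData κ γ) (fE G : IwasawaAlgebra p), D.charIdeal = Ideal.span {fE} →
        iwasawaToPowerSeries p G = padicLFunction f (unitRoot W p : ℚ_[p]) →
        (PowerSeries.map (PadicInt.toZMod (p := p)) G).order ≤ (PowerSeries.map (PadicInt.toZMod (p := p)) fE).order) :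
    MazurMainConjecture W p := by
  intro κ γ hκ hγ hγ' _ f hf ϖ hϖeq D
  obtain ⟨-, hp, hgood, hord, hirr, -⟩ := id hX9
  have hp2 : p ≠ 2 := by omega
  have hordp : IsOrdinaryAt W p := ⟨hgood, hord⟩
  -- the period ratio `ϖ` is a `p`-adic unit
  have hplus : plusPeriod f ≠ 0 := (IsNewform0.plusPeriod_pos_holds hf.1 hf.coeffField_eq_bot).ne'
  have hϖ0 : ϖ ≠ 0 := by
    rintro rfl
    apply hplus
    rw [← hϖeq]
    simp
  have hϖv : padicValRat p ϖ = 0 :=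
    padicValRat_periodRatio_eq_zero_of_five_le h5 W p hp hgood hirr f hf ϖ hϖeq
  have hϖ : ‖(ϖ : ℚ_[p])‖ = 1 := by
    rw [Padic.eq_padicNorm, padicNorm.eq_zpow_of_nonzero hϖ0, hϖv, neg_zero, zpow_zero, Rat.cast_one]
  -- Kato (2): torsion and `ι g₀ = p^n · L_p` with `g₀ ∈ char X`
  obtain ⟨hX, ⟨n, g₀, hg₀, hι₀⟩, -⟩ := hK κ γ f hp2 hordp hκ hγ hγ' hf D
  haveI : Module.Finite (IwasawaAlgebra p) D.X := D.module_finite_holds hγ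
  haveI : (Module.charIdeal (IwasawaAlgebra p) D.X).IsPrincipal := charIdeal_isPrincipal_holds p D.X
  obtain ⟨fE, hchar⟩ := Submodule.IsPrincipal.principal (Module.charIdeal (IwasawaAlgebra p) D.X)
  have hchar' : D.charIdeal = Ideal.span {fE} := hchar
  -- `μ = 0`: `p ∤ fE`
  have hfE : GreenbergVatsal2000.HasUnitContent fE :=
    (GreenbergVatsal2000.mu_eq_zero_iff_hasUnitContent D hX hchar').mp (hμ κ γ hκ hγ hγ' D)
  have hndvd : ¬ (PowerSeries.C (p : ℤ_[p]) : IwasawaAlgebra p) ∣ fE :=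
    (GreenbergVatsal2000.hasUnitContent_iff_not_C_dvd fE).mp hfE
  obtain ⟨h, hgh⟩ := Ideal.mem_span_singleton'.mp (hchar' ▸ hg₀ : g₀ ∈ Ideal.span {fE})
  -- `L_p = ι G`, `G ∈ Λ` (irreducibility)
  obtain ⟨G, hG⟩ := exists_iwasawaToPowerSeries_eq_padicLFunction hp2 hordp hf hirr
  have hιC : iwasawaToPowerSeries p ((PowerSeries.C (p : ℤ_[p]) : IwasawaAlgebra p) ^ n) =
      PowerSeries.C ((p : ℚ_[p]) ^ n) := by
    rw [map_pow, PowerSeries.map_C, map_natCast, map_pow]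
  have hg₀G : g₀ = (PowerSeries.C (p : ℤ_[p]) : IwasawaAlgebra p) ^ n * G := by
    apply iwasawaToPowerSeries_injective p
    rw [hι₀, map_mul, hιC, hG]
  have hdvd : (PowerSeries.C (p : ℤ_[p]) : IwasawaAlgebra p) ^ n ∣ h * fE := ⟨G, hgh.trans hg₀G⟩
  obtain ⟨h', hh'⟩ := (IwasawaAlgebra.prime_C p).pow_dvd_of_dvd_mul_right n hndvd hdvd
  have hpC0 : (PowerSeries.C (p : ℤ_[p]) : IwasawaAlgebra p) ^ n ≠ 0 :=
    pow_ne_zero n (IwasawaAlgebra.prime_C p).ne_zero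
  have hfEh' : fE * h' = G := by
    rw [mul_comm]
    apply mul_left_cancel₀ hpC0
    rw [← hg₀G, ← hgh, hh', mul_assoc]
  -- `μ(G) = 0` from the certificate, and the `λ`-match
  have hGunit : GreenbergVatsal2000.HasUnitContent G :=
    (GreenbergVatsal2000.hasUnitContent_iff_exists_norm_coeff_map_eq_one G).mpr (hG ▸ hcert f hf)
  have hle : (PowerSeries.map (PadicInt.toZMod (p := p)) G).order ≤ (PowerSeries.map (PadicInt.toZMod (p := p)) fE).order := hlam κ γ hκ hγ hγ' f hf D fE G hchar' hG
  have hge : (PowerSeries.map (PadicInt.toZMod (p := p)) fE).order ≤ (PowerSeries.map (PadicInt.toZMod (p := p)) G).order := by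
    rw [← hfEh', map_mul, PowerSeries.order_mul]
    exact le_self_add
  have hunit : IsUnit h' :=
    GreenbergVatsal2000.isUnit_of_mul_eq_of_order_map_eq hfEh' hGunit (le_antisymm hle hge)
  -- `char X = (fE) = (G) = (ϖ · G)`
  have hspanG : Ideal.span ({G} : Set (IwasawaAlgebra p)) = Ideal.span {fE} := by
    rw [← hfEh', mul_comm]
    exact Ideal.span_singleton_mul_left_unit hunit fE
  set c : ℤ_[p] := ⟨(ϖ : ℚ_[p]), hϖ.le⟩ with hc_def
  have hcu : IsUnit c := PadicInt.isUnit_iff.mpr hϖ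
  refine ⟨hX, PowerSeries.C c * G, ?_, ?_⟩
  · rw [hchar', ← hspanG]
    exact (Ideal.span_singleton_mul_left_unit (hcu.map PowerSeries.C) G).symm
  · rw [map_mul, hG, PowerSeries.map_C]
    rfl

/-! ### §2. One coefficient discharges the `λ`-match: the rank-0 unit cell and the rank-1 `[T¹]`-unit cell -/

omit [W.IsElliptic] in
/-- **`hlam` on the rank-0 UNIT cell**: if the CONSTANT coefficient `L_p(f, α)(0)` is a `p`-adic unit
(`hcert0`), then `ord_T(G mod p) = 0 ≤ ord_T(f_E mod p)` for every datum — the certificate of the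
strategy's "r0 unit cells" (`L_p(E,0) = (1 - α⁻¹)² L(E,1)/Ω⁺_f ∈ ℤ_p^×`: non-anomalous and
`L(E,1)/Ω` a `p`-unit). [cite: GreenbergVatsal2000, p. 20] [cite: MazurTateTeitelbaum1986Invent, §I.14] -/
theorem X9.order_le_of_norm_constantCoeff_eq_one
    (hcert0 : ∀ [NeZero (W.conductorNorm ℤ)] (f : CuspForm (Gamma0 (W.conductorNorm ℤ)) 2),
      IsNewformOf W f → ‖PowerSeries.coeff 0 (padicLFunction f (unitRoot W p : ℚ_[p]))‖ = 1) :
    ∀ (κ : ZpExtension ℚ p) (γ : Field.absoluteGaloisGroup ℚ),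
        κ.IsCyclotomic → κ.IsTopGenerator γ → IsCyclotomicVariable p γ →
      ∀ [NeZero (W.conductorNorm ℤ)] (f : CuspForm (Gamma0 (W.conductorNorm ℤ)) 2), IsNewformOf W f →
      ∀ (D : W.SelmerDualData κ γ) (fE G : IwasawaAlgebra p), D.charIdeal = Ideal.span {fE} →
        iwasawaToPowerSeries p G = padicLFunction f (unitRoot W p : ℚ_[p]) →
        (PowerSeries.map (PadicInt.toZMod (p := p)) G).order ≤ (PowerSeries.map (PadicInt.toZMod (p := p)) fE).order := by
  intro κ γ _ _ _ _ f hf D fE G _ hG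
  have h0 : ‖((PowerSeries.coeff 0 G : ℤ_[p]) : ℚ_[p])‖ = 1 := by
    have h := hcert0 f hf
    rw [← hG, PowerSeries.coeff_map] at h
    exact h
  have hu : IsUnit (PowerSeries.coeff 0 G) := PadicInt.isUnit_iff.mpr (by rwa [PadicInt.norm_def])
  have hne : PowerSeries.coeff 0 (PowerSeries.map (PadicInt.toZMod (p := p)) G) ≠ 0 := by
    rw [PowerSeries.coeff_map]
    exact toZMod_ne_zero_of_isUnit p hu
  exact (PowerSeries.order_le 0 hne).trans bot_le

/-- **`hlam` on the rank-1 `[T¹]`-unit cell**: at an X9 pair of analytic rank `1`, if `[T¹]L_p(f, α)` is a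
`p`-adic unit (`hcert1`) then `ord_T(G mod p) ≤ 1 ≤ ord_T(f_E) ≤ ord_T(f_E mod p)` for every datum:
the second inequality is Perrin-Riou–Schneider clause 1 (`T^{rank E(ℚ)} ∣ f_E`, fact
`Schneider1985_order_charGenerator_odd`, `hS`; BMS 2016 Thm. 1.7) with `rank E(ℚ) = 1` (GZK, `hGZK`),
at THE canonical height (exists: `mazur_tate_sigma_exists_odd_holds`); torsion of `X` is Kato's clause
(1) (`hK`). This is the "descent data force `λ_alg ≥ λ_an`" of the strategy at `λ_an = 1`.
[cite: BalakrishnanMullerStein2015, Thm. 1.7] [cite: MazurSteinTate2006, Thm. 1.3]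
[cite: GreenbergVatsal2000, p. 20] [cite: Kato2004Asterisque, Thm. 17.4 (1) (p. 273)] -/
theorem X9.order_le_of_rankOne_of_norm_coeff_one_eq_one (hS : Schneider1985_order_charGenerator_odd)
    (hGZK : rank_eq_analyticRank_of_analyticRank_le_one)
    (hK : ∀ (κ : ZpExtension ℚ p) (γ : Field.absoluteGaloisGroup ℚ) [NeZero (W.conductorNorm ℤ)]
      (f : CuspForm (Gamma0 (W.conductorNorm ℤ)) 2), kato_divisibility W p (κ := κ) (γ := γ) (f := f))
    (hX9 : ClassX9 W p) (hr1 : W.analyticRank = 1)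
    (hcert1 : ∀ [NeZero (W.conductorNorm ℤ)] (f : CuspForm (Gamma0 (W.conductorNorm ℤ)) 2),
      IsNewformOf W f → ‖PowerSeries.coeff 1 (padicLFunction f (unitRoot W p : ℚ_[p]))‖ = 1) :
    ∀ (κ : ZpExtension ℚ p) (γ : Field.absoluteGaloisGroup ℚ),
        κ.IsCyclotomic → κ.IsTopGenerator γ → IsCyclotomicVariable p γ →
      ∀ [NeZero (W.conductorNorm ℤ)] (f : CuspForm (Gamma0 (W.conductorNorm ℤ)) 2), IsNewformOf W f →
      ∀ (D : W.SelmerDualData κ γ) (fE G : IwasawaAlgebra p), D.charIdeal = Ideal.span {fE} →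
        iwasawaToPowerSeries p G = padicLFunction f (unitRoot W p : ℚ_[p]) →
        (PowerSeries.map (PadicInt.toZMod (p := p)) G).order ≤ (PowerSeries.map (PadicInt.toZMod (p := p)) fE).order := by
  intro κ γ hκ hγ hγ' _ f hf D fE G hchar hG
  obtain ⟨-, hp, hgood, hord, -, -⟩ := id hX9
  have hp2 : p ≠ 2 := by omega
  -- `ord_T(G mod p) ≤ 1`: the coefficient of `T¹` is a unit
  have h1 : ‖((PowerSeries.coeff 1 G : ℤ_[p]) : ℚ_[p])‖ = 1 := by
    have h := hcert1 f hf
    rw [← hG, PowerSeries.coeff_map] at h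
    exact h
  have hu : IsUnit (PowerSeries.coeff 1 G) := PadicInt.isUnit_iff.mpr (by rwa [PadicInt.norm_def])
  have hne : PowerSeries.coeff 1 (PowerSeries.map (PadicInt.toZMod (p := p)) G) ≠ 0 := by
    rw [PowerSeries.coeff_map]
    exact toZMod_ne_zero_of_isUnit p hu
  refine (PowerSeries.order_le 1 hne).trans ?_
  -- `1 ≤ ord_T f_E` (Perrin-Riou–Schneider clause 1 at the canonical height, rank one by GZK)
  haveI : Module.Finite (IwasawaAlgebra p) D.X := D.module_finite_holds hγ
  obtain ⟨hX, -, -⟩ := hK κ γ f hp2 ⟨hgood, hord⟩ hκ hγ hγ' hf D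
  obtain ⟨Dh, hDh, -⟩ :=
    existsUnique_isCanonical_of_odd mazur_tate_sigma_exists_odd_holds W p hp2 hgood hord
  obtain ⟨hS1, -, -⟩ := hS W p hp2 hgood hord κ γ hκ hγ hγ' D hX fE hchar Dh hDh
  have hrk : W.mordellWeilRank = 1 := (hGZK W hr1.le).1.trans hr1
  rw [hrk, Nat.cast_one] at hS1
  -- `ord_T f_E ≤ ord_T (f_E mod p)`
  exact le_trans hS1 (PowerSeries.le_order_map _)

/-! ### §3. Headlines on X9 modulo F1: the rank-0 unit cell and the rank-1 `[T¹]`-unit cell -/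

/-- **X9 rank-0 UNIT cell, per pair: F1 + the period unit + ONE coefficient ⟹ Mazur's INTEGRAL main
conjecture at the pair** — indeed `char_Λ X(E/ℚ_∞) = Λ = (L_p(E))`. Binders: F1 (`hfine`:
`kato_divisibility` via `X10.kato_divisibility_of_fine` and `μ = 0` via the X10 lane's unconditional
kernel core `X10.mu_eq_zero_of_fine` at an irreducible NON-surjective odd prime), modularity (`hmodP`,
to run the `μ`-transfer through the newform of level `N_E`), the period unit (`h5`); certificate
`hcert0 : ‖L_p(f, α)(0)‖ = 1`. [cite: Kato2004Asterisque, Thm. 12.5, 12.6 (p. 222), Thm. 17.4 (p. 273) and §17.13 (pp. 279–280)]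
[cite: GreenbergVatsal2000, Prop. 3.7 and p. 20] -/
theorem X9.mazurMainConjecture_of_fine_of_norm_constantCoeff_eq_one
    (hfine : exists_divisibilityInputs_fineQuotient_zeta) (hmodP : nonempty_modularParametrizationData)
    (h5 : realPeriodRat_eq_unit_mul_plusPeriod) (hX9 : ClassX9 W p)
    (hcert0 : ∀ [NeZero (W.conductorNorm ℤ)] (f : CuspForm (Gamma0 (W.conductorNorm ℤ)) 2),
      IsNewformOf W f → ‖PowerSeries.coeff 0 (padicLFunction f (unitRoot W p : ℚ_[p]))‖ = 1) :
    MazurMainConjecture W p := by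
  obtain ⟨-, hp, hgood, hord, hirr, hns⟩ := id hX9
  haveI : NeZero (W.conductorNorm ℤ) := ⟨(W.conductorNorm_pos_holds).ne'⟩
  have hμ : ∀ (κ : ZpExtension ℚ p) (γ : Field.absoluteGaloisGroup ℚ),
        κ.IsCyclotomic → κ.IsTopGenerator γ → IsCyclotomicVariable p γ →
      ∀ (D : W.SelmerDualData κ γ), D.mu = 0 := by
    intro κ γ hκ hγ hγ' D
    obtain ⟨Dm⟩ := hmodP W
    exact Summit.BirchSwinnertonDyer.Rank1Residual.X10.mu_eq_zero_of_fine hfine W p Dm.f (by omega) hgood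
      hord hirr hns Dm.isNewformOf ⟨0, hcert0 Dm.f Dm.isNewformOf⟩ κ γ hκ hγ hγ' D
  exact X9.mazurMainConjecture_of_kato_of_mu_eq_zero_of_order_le W p h5
    (fun κ γ _ f ↦ Summit.BirchSwinnertonDyer.Rank1Residual.X10.kato_divisibility_of_fine hfine W p κ γ
      (W.conductorNorm ℤ) f)
    hX9 hμ (fun f hf ↦ ⟨0, hcert0 f hf⟩) (X9.order_le_of_norm_constantCoeff_eq_one W p hcert0)

/-- **X9 rank-0 UNIT cell, per pair: F1 + PUBLISHED facts + ONE coefficient ⟹ Miller's `BSD(E,p)`.**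
`‖L_p(f, α)(0)‖ = 1` forces `L(E,1) ≠ 0` (`constantCoeff_padicLFunction_ne_zero_iff`), i.e. analytic
rank `0`; then the integral main conjecture at the pair (above) and the cell's rank-0 skeleton
`bsdp_of_mazurMainConjecture_of_analyticRank_eq_zero` (Greenberg LNM 1716 Thm. 4.1 `hGr`, modularity
`hmodP`, GZK `hGZK`; CGLS 2022 proof of Thm. 5.1.4). No `#Ш_an` datum, no descent datum, no BCS fact.
[cite: Kato2004Asterisque, Thm. 12.5, 12.6 (p. 222), Thm. 17.4 (p. 273) and §17.13 (pp. 279–280)]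
[cite: GreenbergLNM1716, Thm. 4.1 (p. 102)] [cite: CastellaEtAl2021, Thm. 5.1.4 and its proof (§5.1.3)]
[cite: Miller2011LMS, Def. 1.1 (arXiv:1010.2431 p. 3)] -/
theorem X9.bsdp_of_fine_of_norm_constantCoeff_eq_one
    (hfine : exists_divisibilityInputs_fineQuotient_zeta) (hGr : greenberg_charValue_rankZero)
    (hmodP : nonempty_modularParametrizationData) (hGZK : rank_eq_analyticRank_of_analyticRank_le_one)
    (h5 : realPeriodRat_eq_unit_mul_plusPeriod) (hX9 : ClassX9 W p)
    (hcert0 : ∀ [NeZero (W.conductorNorm ℤ)] (f : CuspForm (Gamma0 (W.conductorNorm ℤ)) 2),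
      IsNewformOf W f → ‖PowerSeries.coeff 0 (padicLFunction f (unitRoot W p : ℚ_[p]))‖ = 1) :
    BSDp W p := by
  obtain ⟨-, hp, hgood, hord, -, -⟩ := id hX9
  haveI : NeZero (W.conductorNorm ℤ) := ⟨(W.conductorNorm_pos_holds).ne'⟩
  obtain ⟨Dm⟩ := hmodP W
  -- analytic rank `0`: `L_p(0) ≠ 0 ⟹ L(E,1) ≠ 0`
  have hc0 : PowerSeries.constantCoeff (padicLFunction Dm.f (unitRoot W p : ℚ_[p])) ≠ 0 := by
    rw [← PowerSeries.coeff_zero_eq_constantCoeff_apply, ← norm_ne_zero_iff, hcert0 Dm.f Dm.isNewformOf]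
    exact one_ne_zero
  have hL : W.entireLFunction 1 ≠ 0 :=
    (constantCoeff_padicLFunction_ne_zero_iff W p ⟨hgood, hord⟩ Dm.isNewformOf).mp hc0
  have hr0 : W.analyticRank = 0 :=
    (W.analyticRank_eq_zero_iff_holds Dm.isNewformOf.hasEntireLFunction).mpr hL
  exact Summit.BirchSwinnertonDyer.Rank1Residual.bsdp_of_mazurMainConjecture_of_analyticRank_eq_zero hGr
    hmodP hGZK (by omega) ⟨hgood, hord⟩ hr0
    (X9.mazurMainConjecture_of_fine_of_norm_constantCoeff_eq_one W p hfine hmodP h5 hX9 hcert0)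

/-- **X9 rank-1 `[T¹]`-unit cell, per pair: F1 + Perrin-Riou–Schneider + GZK + the period unit + ONE
coefficient ⟹ Mazur's INTEGRAL main conjecture at the pair.** Binders: F1 (`hfine`), `hS`
(Perrin-Riou–Schneider at odd `p`, clause 1 only), `hGZK` (rank `= 1`), modularity (`hmodP`), the period
unit (`h5`); `hr1 : ord_{s=1} L(E,s) = 1`; certificate `hcert1 : ‖[T¹]L_p(f, α)‖ = 1`.
[cite: Kato2004Asterisque, Thm. 12.5, 12.6 (p. 222), Thm. 17.4 (p. 273) and §17.13 (pp. 279–280)]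
[cite: BalakrishnanMullerStein2015, Thm. 1.7] [cite: GreenbergVatsal2000, Prop. 3.7 and p. 20] -/
theorem X9.mazurMainConjecture_rankOne_of_fine_of_norm_coeff_one_eq_one
    (hfine : exists_divisibilityInputs_fineQuotient_zeta) (hS : Schneider1985_order_charGenerator_odd)
    (hmodP : nonempty_modularParametrizationData) (hGZK : rank_eq_analyticRank_of_analyticRank_le_one)
    (h5 : realPeriodRat_eq_unit_mul_plusPeriod) (hX9 : ClassX9 W p) (hr1 : W.analyticRank = 1)
    (hcert1 : ∀ [NeZero (W.conductorNorm ℤ)] (f : CuspForm (Gamma0 (W.conductorNorm ℤ)) 2),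
      IsNewformOf W f → ‖PowerSeries.coeff 1 (padicLFunction f (unitRoot W p : ℚ_[p]))‖ = 1) :
    MazurMainConjecture W p := by
  obtain ⟨-, hp, hgood, hord, hirr, hns⟩ := id hX9
  haveI : NeZero (W.conductorNorm ℤ) := ⟨(W.conductorNorm_pos_holds).ne'⟩
  have hK : ∀ (κ : ZpExtension ℚ p) (γ : Field.absoluteGaloisGroup ℚ) [NeZero (W.conductorNorm ℤ)]
      (f : CuspForm (Gamma0 (W.conductorNorm ℤ)) 2), kato_divisibility W p (κ := κ) (γ := γ) (f := f) :=
    fun κ γ _ f ↦ Summit.BirchSwinnertonDyer.Rank1Residual.X10.kato_divisibility_of_fine hfine W p κ γ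
      (W.conductorNorm ℤ) f
  have hμ : ∀ (κ : ZpExtension ℚ p) (γ : Field.absoluteGaloisGroup ℚ),
        κ.IsCyclotomic → κ.IsTopGenerator γ → IsCyclotomicVariable p γ →
      ∀ (D : W.SelmerDualData κ γ), D.mu = 0 := by
    intro κ γ hκ hγ hγ' D
    obtain ⟨Dm⟩ := hmodP W
    exact Summit.BirchSwinnertonDyer.Rank1Residual.X10.mu_eq_zero_of_fine hfine W p Dm.f (by omega) hgood
      hord hirr hns Dm.isNewformOf ⟨1, hcert1 Dm.f Dm.isNewformOf⟩ κ γ hκ hγ hγ' D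
  exact X9.mazurMainConjecture_of_kato_of_mu_eq_zero_of_order_le W p h5 hK hX9 hμ
    (fun f hf ↦ ⟨1, hcert1 f hf⟩) (X9.order_le_of_rankOne_of_norm_coeff_one_eq_one W p hS hGZK hK hX9 hr1 hcert1)

/-- **X9 rank-1 `[T¹]`-unit cell, per pair: F1 + PUBLISHED facts + ONE coefficient ⟹ Miller's
`BSD(E,p)`.** The same coefficient is (i) the `μ_an = 0` certificate, (ii) the `λ`-match `λ_an = 1`, and
(iii) the Schneider certificate `Reg_p(E) ≠ 0` at THE canonical height (Perrin-Riou's `p`-adic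
Gross–Zagier, `coeff_one_padicLFunction_ne_zero_iff_schneider_odd`, `hPR`); the integral main conjecture
at the pair then feeds the cell's rank-1 skeleton
`bsdp_of_mazurMainConjecture_of_analyticRank_eq_one_of_schneider_odd` (`hS`, `hPR`, `hmodP`, `hGZK`; the
Mazur–Tate `σ` is `mazur_tate_sigma_exists_odd_holds`). No `#Ш_an` datum, no BCS fact.
[cite: Kato2004Asterisque, Thm. 12.5, 12.6 (p. 222), Thm. 17.4 (p. 273) and §17.13 (pp. 279–280)]
[cite: PerrinRiou1987, §1.4 Cor. 1.8] [cite: BalakrishnanMullerStein2015, Thm. 1.7]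
[cite: Miller2011LMS, Def. 1.1 (arXiv:1010.2431 p. 3)] -/
theorem X9.bsdp_rankOne_of_fine_of_norm_coeff_one_eq_one
    (hfine : exists_divisibilityInputs_fineQuotient_zeta) (hS : Schneider1985_order_charGenerator_odd)
    (hPR : perrinRiou_rankOne_leadingTerms_odd) (hmodP : nonempty_modularParametrizationData)
    (hGZK : rank_eq_analyticRank_of_analyticRank_le_one) (h5 : realPeriodRat_eq_unit_mul_plusPeriod)
    (hX9 : ClassX9 W p) (hr1 : W.analyticRank = 1)
    (hcert1 : ∀ [NeZero (W.conductorNorm ℤ)] (f : CuspForm (Gamma0 (W.conductorNorm ℤ)) 2),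
      IsNewformOf W f → ‖PowerSeries.coeff 1 (padicLFunction f (unitRoot W p : ℚ_[p]))‖ = 1) :
    BSDp W p := by
  obtain ⟨-, hp, hgood, hord, -, -⟩ := id hX9
  have hp2 : p ≠ 2 := by omega
  haveI : NeZero (W.conductorNorm ℤ) := ⟨(W.conductorNorm_pos_holds).ne'⟩
  obtain ⟨Dm⟩ := hmodP W
  -- the Schneider certificate from the same coefficient
  have hSch : ∀ Dh : PAdicHeightData W p, Dh.IsCanonical → SchneiderConjecture Dh := by
    intro Dh hDh
    refine (coeff_one_padicLFunction_ne_zero_iff_schneider_odd hPR hGZK W p hp2 ⟨hgood, hord⟩ hr1 Dh hDh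
      Dm.f Dm.isNewformOf).mp ?_
    rw [← norm_ne_zero_iff, hcert1 Dm.f Dm.isNewformOf]
    exact one_ne_zero
  exact Summit.BirchSwinnertonDyer.Rank1Residual.bsdp_of_mazurMainConjecture_of_analyticRank_eq_one_of_schneider_odd
    hS hPR mazur_tate_sigma_exists_odd_holds hmodP hGZK hp2 ⟨hgood, hord⟩ hr1 hSch
    (X9.mazurMainConjecture_rankOne_of_fine_of_norm_coeff_one_eq_one W p hfine hS hmodP hGZK h5 hX9 hr1
      hcert1)

end Summit.BirchSwinnertonDyer.BirchSwinnertonDyer.Rank1Residual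

end
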